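/-
Copyright: pub-balaban β-flow team, β-FLOW PROVER 4 (unit `b2b-balaban-beta-bflow-p4`, gen 9; coordinator ruling «YM
ACCELERATION» 2026-08-21 item (2), «work behind the as-printed interface»).  [folklore] lattice calculus on `ℤ^d` used by
PART 21 (`Beta.EriceQuadraticFormDecomposition`): one-step path induction, first ∕ second order lattice Taylor bounds,
finite-support sums, shifts and summation by parts.  Nothing of Bałaban's is asserted; NOT B12 Thm 2, NOT BetaPertH,
NOT continuum, NOT Clay.
-/
import Mathlib
import Literature.MathematicalPhysics.QuantumFieldTheory.Balaban1983to89.Beta.PolarizationSign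

/-!
# `Beta.EriceQuadraticFormTaylor` — PART 21a of the `EriceLoopExpansionD4` series: lattice Taylor ∕ summation-by-parts toolkit

T. Bałaban, *Renormalization group approach to lattice gauge field theories. I*, Commun. Math. Phys. **109** (1987) 249–301
[Balaban1987RG1], p. 288 L17–L18: *"We have the following Taylor's formula on a unit lattice, analogous to the formula (3.10)
[7]"* (4.30); p. 298 L1–L4: *"In the third order terms in (5.43) we can always shift the derivatives onto the other function,
so we can write them in the form in which δB is differentiated once, and B twice."*  This file supplies the [folklore]
lattice calculus behind those two sentences, for real functions on `ℤ^d` (`Fin d → ℤ`; `e_α` = `B6BondElimination.unitVec α`,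
`∂_α u(x) = u(x + e_α) − u(x)`, `|z|₁ = Σ_i |z_i|`):

* §1 `exists_step` (a nonzero lattice vector is one unit step away from a shorter one), **`abs_sub_le_of_step_bound`**
  (`|u(x+z) − u(x)| ≤ b₁·|z|₁` from a bound `b₁` on the unit steps), **`abs_taylor2_le`** (`|u(x+z) − u(x) − Σ_α z_α ∂_α u(x)|
  ≤ b₂·|z|₁²` from a bound `b₂` on all second differences).
* §2 finitely supported functions summed over `ℤ^d` as `tsum`s: the card·sup bound `abs_tsum_le_card_mul`, the shift
  `tsum_shift`, summation by parts `tsum_fwdDiff_mul_eq`.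
The two bilinear estimates built on these (increment form vs. its second-order part; the gradient-form commutator) are
PART 21a′ `Beta.EriceQuadraticFormIncrements`.
HONEST: elementary; no kernel, no physics. NOT B12 Thm 2, NOT BetaPertH, NOT continuum, NOT Clay.
-/

namespace Summit.QuantumFields.BalabanUV.Beta.EriceQuadraticFormTaylor

open Literature.MathematicalPhysics.QuantumFieldTheory.Balaban1983to89
open Literature.MathematicalPhysics.QuantumFieldTheory.Balaban1983to89.Beta.PolarizationSign (sum_abs_nonneg)
open Literature.MathematicalPhysics.QuantumFieldTheory.Balaban1983to89.B6BondElimination (unitVec unitVec_apply)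
open scoped BigOperators

attribute [local simp] Literature.MathematicalPhysics.QuantumFieldTheory.Balaban1983to89.B6BondElimination.unitVec_apply

variable {d : ℕ}

/-! ## §1. One-step path induction and the lattice Taylor bounds -/

section Path

/-- `Σ_i |z_i| = 0` iff `z = 0`. [folklore] -/
theorem sum_abs_eq_zero_iff (z : Fin d → ℤ) : (∑ i, |(z i : ℝ)|) = 0 ↔ z = 0 := by
  rw [Finset.sum_eq_zero_iff_of_nonneg (fun i _ => abs_nonneg _)]
  constructor
  · intro h; funext i
    have := abs_eq_zero.mp (h i (Finset.mem_univ i))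
    exact_mod_cast this
  · intro h i _; simp [h]

/-- Splitting a coordinate sum at one index. [folklore] -/
theorem sum_abs_eq_add_erase (w : Fin d → ℤ) (i : Fin d) :
    (∑ j, |(w j : ℝ)|) = |(w i : ℝ)| + ∑ j ∈ Finset.univ.erase i, |(w j : ℝ)| :=
  (Finset.add_sum_erase _ _ (Finset.mem_univ i)).symm

/-- `Σ_α (s·e_i)_α D_α = s·D_i`. [folklore] -/
theorem sum_smul_unitVec_mul (i : Fin d) (s : ℤ) (D : Fin d → ℝ) :
    (∑ α, (((s • unitVec i) α : ℤ) : ℝ) * D α) = (s : ℝ) * D i := by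
  have e : ∀ α, (((s • unitVec i) α : ℤ) : ℝ) * D α = if α = i then (s : ℝ) * D i else 0 := by
    intro α
    by_cases h : α = i
    · subst h; simp
    · simp [h]
  simp_rw [e]
  simp

/-- **One step**: a nonzero `z ∈ ℤ^d` is `z' ± e_i` with `|z'|₁ = |z|₁ − 1`. [folklore] -/
theorem exists_step {z : Fin d → ℤ} (hz : z ≠ 0) :
    ∃ (i : Fin d) (s : ℤ) (z' : Fin d → ℤ), (s = 1 ∨ s = -1) ∧ z = z' + s • unitVec i ∧
      (∑ j, |(z' j : ℝ)|) = (∑ j, |(z j : ℝ)|) - 1 := by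
  obtain ⟨i, hi⟩ : ∃ i, z i ≠ 0 := by
    by_contra h
    push Not at h
    exact hz (funext h)
  have herase : ∀ (w : Fin d → ℤ) (t : ℤ), (∑ j ∈ Finset.univ.erase i, |((w + t • unitVec i) j : ℝ)|)
      = ∑ j ∈ Finset.univ.erase i, |(w j : ℝ)| := by
    intro w t
    refine Finset.sum_congr rfl fun j hj => ?_
    have hji : j ≠ i := Finset.ne_of_mem_erase hj
    simp [hji]
  rcases lt_or_gt_of_ne hi with hneg | hpos
  · refine ⟨i, -1, z + unitVec i, Or.inr rfl, ?_, ?_⟩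
    · rw [neg_smul, one_smul, add_neg_cancel_right]
    · have h1 : (z i : ℝ) ≤ -1 := by exact_mod_cast (show z i ≤ -1 by omega)
      rw [sum_abs_eq_add_erase _ i, sum_abs_eq_add_erase z i]
      have h2 := herase z 1
      rw [one_smul] at h2
      rw [h2]
      have e : (((z + unitVec i) i : ℤ) : ℝ) = (z i : ℝ) + 1 := by simp
      rw [e, abs_of_nonpos (by linarith), abs_of_neg (by linarith)]
      ring
  · refine ⟨i, 1, z - unitVec i, Or.inl rfl, ?_, ?_⟩
    · rw [one_smul, sub_add_cancel]
    · have h1 : (1 : ℝ) ≤ (z i : ℝ) := by exact_mod_cast (show 1 ≤ z i by omega)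
      rw [sum_abs_eq_add_erase _ i, sum_abs_eq_add_erase z i]
      have h2 := herase z (-1)
      rw [neg_smul, one_smul, ← sub_eq_add_neg] at h2
      rw [h2]
      have e : (((z - unitVec i) i : ℤ) : ℝ) = (z i : ℝ) - 1 := by simp
      rw [e, abs_of_nonneg (by linarith), abs_of_pos (by linarith)]
      ring

/-- **First-order path bound**: if every unit step of `u` is at most `b₁` in size, then `|u(x+z) − u(x)| ≤ b₁·Σ_i|z_i|`
(induction on `|z|₁`, one unit step at a time). [folklore] -/
theorem abs_sub_le_of_step_bound (u : (Fin d → ℤ) → ℝ) {b₁ : ℝ}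
    (hb : ∀ (α : Fin d) (y : Fin d → ℤ), |u (y + unitVec α) - u y| ≤ b₁) (x z : Fin d → ℤ) :
    |u (x + z) - u x| ≤ b₁ * ∑ i, |(z i : ℝ)| := by
  suffices h : ∀ (n : ℕ) (z : Fin d → ℤ), (∑ i, |(z i : ℝ)|) ≤ n → |u (x + z) - u x| ≤ b₁ * ∑ i, |(z i : ℝ)| from
    h _ z (Nat.le_ceil _)
  intro n
  induction n with
  | zero =>
      intro z hz
      have h0 : z = 0 := (sum_abs_eq_zero_iff z).mp (le_antisymm (by exact_mod_cast hz) (sum_abs_nonneg z))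
      subst h0
      simp
  | succ n ih =>
      intro z hz
      by_cases hz0 : z = 0
      · subst hz0; simp
      obtain ⟨i, s, z', hs, rfl, hlen⟩ := exists_step hz0
      have ih' := ih z' (by rw [hlen]; push_cast at hz ⊢; linarith)
      have hstep : |u (x + (z' + s • unitVec i)) - u (x + z')| ≤ b₁ := by
        rcases hs with rfl | rfl
        · rw [one_smul, ← add_assoc]; exact hb i (x + z')
        · have h := hb i (x + z' - unitVec i)
          rw [sub_add_cancel] at h
          rw [neg_smul, one_smul, ← sub_eq_add_neg, ← add_sub_assoc, abs_sub_comm]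
          exact h
      calc |u (x + (z' + s • unitVec i)) - u x|
          ≤ |u (x + (z' + s • unitVec i)) - u (x + z')| + |u (x + z') - u x| := abs_sub_le _ _ _
        _ ≤ b₁ + b₁ * ∑ i, |(z' i : ℝ)| := add_le_add hstep ih'
        _ = b₁ * ∑ j, |((z' + s • unitVec i) j : ℝ)| := by rw [hlen]; ring

/-- **Second-order lattice Taylor bound**: if every second difference `u(y+e_α+e_β) − u(y+e_α) − u(y+e_β) + u(y)` is at most
`b₂` in size, then `|u(x+z) − u(x) − Σ_α z_α ∂_α u(x)| ≤ b₂·(Σ_i|z_i|)²` ([Balaban1987RG1] (4.30) is the exact formula along a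
contour; only the bound is needed). [folklore] -/
theorem abs_taylor2_le (u : (Fin d → ℤ) → ℝ) {b₂ : ℝ}
    (hb : ∀ (α β : Fin d) (y : Fin d → ℤ),
      |u (y + unitVec α + unitVec β) - u (y + unitVec α) - u (y + unitVec β) + u y| ≤ b₂) (x z : Fin d → ℤ) :
    |u (x + z) - u x - ∑ α, (z α : ℝ) * (u (x + unitVec α) - u x)| ≤ b₂ * (∑ i, |(z i : ℝ)|) ^ 2 := by
  -- the first differences `D α y = u (y + e_α) − u y` have unit steps bounded by `b₂`
  have hD : ∀ (α β : Fin d) (y : Fin d → ℤ),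
      |(u (y + unitVec β + unitVec α) - u (y + unitVec β)) - (u (y + unitVec α) - u y)| ≤ b₂ := by
    intro α β y
    have h := hb β α y
    have e : u (y + unitVec β + unitVec α) - u (y + unitVec β) - (u (y + unitVec α) - u y)
        = u (y + unitVec β + unitVec α) - u (y + unitVec β) - u (y + unitVec α) + u y := by ring
    rw [e]; exact h
  have hfirst : ∀ (α : Fin d) (w : Fin d → ℤ),
      |(u (x + w + unitVec α) - u (x + w)) - (u (x + unitVec α) - u x)| ≤ b₂ * ∑ i, |(w i : ℝ)| := by
    intro α w
    have h := abs_sub_le_of_step_bound (fun y => u (y + unitVec α) - u y) (fun β y => hD α β y) x w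
    exact h
  suffices h : ∀ (n : ℕ) (z : Fin d → ℤ), (∑ i, |(z i : ℝ)|) ≤ n →
      |u (x + z) - u x - ∑ α, (z α : ℝ) * (u (x + unitVec α) - u x)| ≤ b₂ * (∑ i, |(z i : ℝ)|) ^ 2 from
    h _ z (Nat.le_ceil _)
  intro n
  induction n with
  | zero =>
      intro z hz
      have h0 : z = 0 := (sum_abs_eq_zero_iff z).mp (le_antisymm (by exact_mod_cast hz) (sum_abs_nonneg z))
      subst h0
      simp
  | succ n ih =>
      intro z hz
      by_cases hz0 : z = 0
      · subst hz0; simp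
      obtain ⟨i, s, z', hs, rfl, hlen⟩ := exists_step hz0
      set ℓ : ℝ := ∑ j, |((z' + s • unitVec i) j : ℝ)| with hℓ
      have hℓ' : (∑ j, |(z' j : ℝ)|) = ℓ - 1 := hlen
      have hℓ1 : 1 ≤ ℓ := by linarith [sum_abs_nonneg z']
      have hb0 : 0 ≤ b₂ := (abs_nonneg _).trans (hb i i x)
      have ih' := ih z' (by rw [hℓ']; push_cast at hz; linarith)
      -- the increment of the remainder along the last step
      have hsum : (∑ α, (((z' + s • unitVec i) α : ℤ) : ℝ) * (u (x + unitVec α) - u x))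
          = (∑ α, (z' α : ℝ) * (u (x + unitVec α) - u x)) + (s : ℝ) * (u (x + unitVec i) - u x) := by
        rw [← sum_smul_unitVec_mul i s (fun α => u (x + unitVec α) - u x), ← Finset.sum_add_distrib]
        refine Finset.sum_congr rfl fun α _ => ?_
        simp only [Pi.add_apply, Int.cast_add, add_mul]
      have hstep : |u (x + (z' + s • unitVec i)) - u (x + z') - (s : ℝ) * (u (x + unitVec i) - u x)| ≤ b₂ * ℓ := by
        rcases hs with rfl | rfl
        · have h := hfirst i z'
          rw [hℓ'] at h
          have e : u (x + (z' + (1 : ℤ) • unitVec i)) - u (x + z') - ((1 : ℤ) : ℝ) * (u (x + unitVec i) - u x)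
              = (u (x + z' + unitVec i) - u (x + z')) - (u (x + unitVec i) - u x) := by
            rw [one_smul, ← add_assoc]; push_cast; ring
          rw [e]
          exact h.trans (by nlinarith)
        · have h := hfirst i (z' + (-1 : ℤ) • unitVec i)
          have e : u (x + (z' + (-1 : ℤ) • unitVec i)) - u (x + z') - ((-1 : ℤ) : ℝ) * (u (x + unitVec i) - u x)
              = -((u (x + (z' + (-1 : ℤ) • unitVec i) + unitVec i) - u (x + (z' + (-1 : ℤ) • unitVec i)))
                  - (u (x + unitVec i) - u x)) := by
            have e2 : x + (z' + (-1 : ℤ) • unitVec i) + unitVec i = x + z' := by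
              rw [neg_smul, one_smul, ← add_assoc, neg_add_cancel_right]
            rw [e2]; push_cast; ring
          rw [e, abs_neg]
          exact h
      have key : u (x + (z' + s • unitVec i)) - u x - ∑ α, (((z' + s • unitVec i) α : ℤ) : ℝ) * (u (x + unitVec α) - u x)
          = (u (x + z') - u x - ∑ α, (z' α : ℝ) * (u (x + unitVec α) - u x))
            + (u (x + (z' + s • unitVec i)) - u (x + z') - (s : ℝ) * (u (x + unitVec i) - u x)) := by
        rw [hsum]; ring
      rw [key]
      calc |(u (x + z') - u x - ∑ α, (z' α : ℝ) * (u (x + unitVec α) - u x))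
            + (u (x + (z' + s • unitVec i)) - u (x + z') - (s : ℝ) * (u (x + unitVec i) - u x))|
          ≤ b₂ * (∑ j, |(z' j : ℝ)|) ^ 2 + b₂ * ℓ := (abs_add_le _ _).trans (add_le_add ih' hstep)
        _ = b₂ * ((ℓ - 1) ^ 2 + ℓ) := by rw [hℓ']; ring
        _ ≤ b₂ * ℓ ^ 2 := by
            apply mul_le_mul_of_nonneg_left _ hb0
            nlinarith

end Path

/-! ## §2. Finitely supported functions on `ℤ^d`: sums, shifts, summation by parts -/

section Sums

/-- The card·sup bound for a finitely supported summand. [folklore] -/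
theorem abs_tsum_le_card_mul {f : (Fin d → ℤ) → ℝ} {T : Finset (Fin d → ℤ)} (hT : ∀ x ∉ T, f x = 0) {c : ℝ}
    (hc : ∀ x, |f x| ≤ c) : |∑' x, f x| ≤ T.card * c := by
  rw [tsum_eq_sum (s := T) hT]
  calc |∑ x ∈ T, f x| ≤ ∑ x ∈ T, |f x| := Finset.abs_sum_le_sum_abs _ _
    _ ≤ ∑ _x ∈ T, c := Finset.sum_le_sum fun x _ => hc x
    _ = T.card * c := by rw [Finset.sum_const, nsmul_eq_mul]

/-- Shift invariance of the lattice sum. [folklore] -/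
theorem tsum_shift (f : (Fin d → ℤ) → ℝ) (c : Fin d → ℤ) : (∑' x, f (x + c)) = ∑' x, f x :=
  (Equiv.addRight c).tsum_eq f

/-- A function vanishing off `S`, read at `x + c`, vanishes off `S.image (· - c)`. [folklore] -/
theorem shift_vanish {u : (Fin d → ℤ) → ℝ} {S : Finset (Fin d → ℤ)} (hu : ∀ x ∉ S, u x = 0) (c x : Fin d → ℤ)
    (hx : x ∉ S.image (· - c)) : u (x + c) = 0 := by
  apply hu
  intro h
  exact hx (Finset.mem_image.mpr ⟨x + c, h, by simp⟩)

/-- **Summation by parts** on `ℤ^d`: `Σ_x (u(x+e) − u(x))·w(x) = Σ_x u(x)·(w(x−e) − w(x))` for finitely supported `u`.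
[folklore] -/
theorem tsum_fwdDiff_mul_eq (u w : (Fin d → ℤ) → ℝ) {S : Finset (Fin d → ℤ)} (hu : ∀ x ∉ S, u x = 0)
    (e : Fin d → ℤ) :
    (∑' x, (u (x + e) - u x) * w x) = ∑' x, u x * (w (x - e) - w x) := by
  have h1 : Summable fun x => u (x + e) * w x :=
    summable_of_ne_finset_zero (s := S.image (· - e)) fun x hx => by rw [shift_vanish hu e x hx, zero_mul]
  have h2 : Summable fun x => u x * w x :=
    summable_of_ne_finset_zero (s := S) fun x hx => by rw [hu x hx, zero_mul]
  have h3 : Summable fun x => u x * w (x - e) :=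
    summable_of_ne_finset_zero (s := S) fun x hx => by rw [hu x hx, zero_mul]
  have hshift : (∑' x, u (x + e) * w x) = ∑' x, u x * w (x - e) := by
    rw [← tsum_shift (fun x => u x * w (x - e)) e]
    exact tsum_congr fun x => by rw [add_sub_cancel_right]
  calc (∑' x, (u (x + e) - u x) * w x) = ∑' x, (u (x + e) * w x - u x * w x) := tsum_congr fun x => by ring
    _ = (∑' x, u (x + e) * w x) - ∑' x, u x * w x := h1.tsum_sub h2
    _ = (∑' x, u x * w (x - e)) - ∑' x, u x * w x := by rw [hshift]
    _ = ∑' x, (u x * w (x - e) - u x * w x) := (h3.tsum_sub h2).symm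
    _ = ∑' x, u x * (w (x - e) - w x) := tsum_congr fun x => by ring

end Sums

end Summit.QuantumFields.BalabanUV.Beta.EriceQuadraticFormTaylor
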